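import Summits.Ventures.LatticeQCDFlow.Exactness.IMHDirichletForm
import Summits.Ventures.LatticeQCDFlow.Exactness.FlowSamplerTauIntFloor
import Summits.Ventures.LatticeQCDFlow.Exactness.ReversibleAutocovMonotone
import Summits.Ventures.LatticeQCDFlow.Exactness.MetropolisLineEnergyBound
import Literature.Analysis.FunctionSpaces.TorusLipschitzFourierH1
import HarnessLib

/-!
# VOLUME SLOWING DOWN of the flow arm, typed: `τ_int(f) ≥ (e²/4) Var_π(f) − ½` for every observable moving no more than the log-weight

HONEST FRAMING: exact (Metropolis-corrected) sampling algorithms for lattice gauge theory;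
figures of merit are autocorrelation/cost numbers at stated couplings and volumes; no
continuum-physics claim.  (SCALAR calibration rung S0-A: not a gauge result.)

Venture `LatticeQCDFlow` (cell pub-lqcd), topic `Exactness`; FANOUT row 2 (`s0-phi4`, FLOW arm — the
row's "dynamical exponents z" deliverable from the side of THEOREMS, in the form the flow literature
reports: the variance under the target of the log importance weight, i.e. of the reweighting energy
`S − S_model`).  NEW WORK of the cell, composing `IMHDirichletForm.dirichlet_eq_half_sq` (the
Dirichlet form of the flow sampler is `½ ∫∫ s (v − v')²`, `s = min(w q', w' q)` its symmetrised flow),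
`MetropolisLineEnergyBound.accept_mul_sq_le` (`min(1, e^{−Δ}) Δ² ≤ 4e^{−2}(1 + e^{−Δ})`),
`FlowSamplerTauIntFloor.imhOp_tauInt_ge` (Madras–Slade for the sampler) and
`ReversibleAutocovMonotone` (`RevOp.floor_transfer`).  Nothing is cited as a fact.  Printed counterpart, NAMED
ONLY: Caracciolo–Pelissetto–Sokal, PRL 72 (1994) 179, Theorem — for a Metropolis algorithm whose
proposal satisfies detailed balance for `π⁰`, `τ_int,H ≥ (e²/4) var(H)/f₊ − ½` with
`H = −log(π/π⁰)` (discrete state space; "the same considerations apply with minor modifications to a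
general measurable state space").  The flow sampler IS that situation with `π⁰ =` the model density
`q̃` and `H = −log(w/q̃)` the negative log importance weight; here the general-measurable-space
statement is typed (factor `f₊ ≤ 1` dropped) with the lattice φ⁴ instance.

## What is proved (`w, q > 0` measurable integrable, `∫ q = 1`, `Z = ∫ w`, `b = w/q`, `K = imhOp μ w q`)

* `imhFlow_eq_mul_accept` — `s(t,t') = w(t) q(t') min(1, e^{−Δ})`, `Δ = log b(t) − log b(t')`;
  `imhFlow_mul_sq_log_le` — pointwise `s(t,t') Δ² ≤ 4e^{−2}(w(t) q(t') + w(t') q(t))`;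
* **`integral_imhFlow_mul_sq_sub_le`** — for `v` bounded measurable with
  `|v(t) − v(t')| ≤ |log b(t) − log b(t')|`: `∫∫ s (v − v')² ≤ 8e^{−2} Z`;
  **`imh_dirichlet_le_logWeight`** — hence `∫ v² w − ∫ v (Kv) w ≤ 4e^{−2} Z` (the mean squared
  accepted change of the log-weight per step is at most `8/e²`);
* **`imhOp_tauInt_ge_logWeight`** — summable autocorrelation series and `ρ(1) < 1` ⇒
  `τ_int(v) ≥ (e²/4) (∫ v² w)/Z − ½`;
* lattice φ⁴ (`λ > 0`, any `J`, any positive model density `q̃` — any normalizing flow):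
  `log(e^{−S}/q̃) = −(S + log q̃)`, **`phi4Flow_tauInt_ge_logWeight`** — `f` bounded measurable with
  `|f ψ − f φ| ≤ |(S ψ + log q̃ ψ) − (S φ + log q̃ φ)|`, `g = f − ⟨f⟩`:
  `τ_int(f) ≥ (e²/4) ⟨(f − ⟨f⟩)²⟩ − ½`; instance **`phi4Flow_tauInt_ge_clipReweight`** — the clipped
  reweighting energy `max(−c, min(c, S + log q̃))` at every clip level `c`.

Reading (no numerics implied).  Write `σ²_π = Var_π(S − S_q̃)`, `S_q̃ = −log q̃`, for the variance under
the TARGET of the reweighting energy of a trained flow.  The exact (Metropolised) flow sampler needs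
`τ_int ≥ (e²/4)·Var_π(clip_c(S − S_q̃)) − ½ → 1.85 σ²_π − ½` steps per independent value of that
observable: a flow whose mismatch is extensive (`σ²_π ≈ V s²`) is slowed down at least LINEARLY in the
volume, for every architecture — the polynomial face of the flow arm's volume barrier, complementing
the ESS face of gens 11–12 (`IMHTauIntLeInvESS` / `IMHSignObservableSandwich`: `1/κ − ½ ≤ τ ≤ ½ + 12/κ`
on sign observables).  NOT CLAIMED: the exponential truth for large `σ²` (the floor is quadratic in
the log-weight, not exponential); `ρ(1) < 1` / summability for any run (hypotheses); any value of
`σ²_π`; CPS's factor `f₊`.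
-/

namespace Summit.Ventures.LatticeQCDFlow.Exactness

open Real MeasureTheory Filter Set
open Summit.Ventures.LatticeQCDFlow.Scoring

section LogWeight

variable {X : Type*} [MeasurableSpace X] {μ : Measure X} {w q : X → ℝ}

omit [MeasurableSpace X] in
/-- **The symmetrised flow in Metropolis form**: `s(t,t') = w(t) q(t') · min(1, e^{−Δ})` with
`Δ = log b(t) − log b(t')`, `b = w/q` (`e^{−Δ} = b(t')/b(t)`). -/
theorem imhFlow_eq_mul_accept (hw0 : ∀ t, 0 < w t) (hq0 : ∀ t, 0 < q t) (t t' : X) :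
    imhFlow w q t t'
      = w t * q t' * min 1 (Real.exp (-(Real.log (w t / q t) - Real.log (w t' / q t')))) := by
  have hb : 0 < w t / q t := div_pos (hw0 t) (hq0 t)
  have hb' : 0 < w t' / q t' := div_pos (hw0 t') (hq0 t')
  have he : Real.exp (-(Real.log (w t / q t) - Real.log (w t' / q t')))
      = (w t' / q t') / (w t / q t) := by
    rw [neg_sub, Real.exp_sub, Real.exp_log hb', Real.exp_log hb]
  have hq := hq0 t
  have hq' := hq0 t'
  have hw := hw0 t
  rw [he, mul_min_of_nonneg _ _ (mul_pos (hw0 t) (hq0 t')).le, mul_one]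
  unfold imhFlow
  congr 1
  field_simp

omit [MeasurableSpace X] in
/-- **Pointwise CPS bound for the flow sampler**: `s(t,t') (log b(t) − log b(t'))² ≤ 4e^{−2}(w(t) q(t') + w(t') q(t))`. -/
theorem imhFlow_mul_sq_log_le (hw0 : ∀ t, 0 < w t) (hq0 : ∀ t, 0 < q t) (t t' : X) :
    imhFlow w q t t' * (Real.log (w t / q t) - Real.log (w t' / q t')) ^ 2
      ≤ 4 * Real.exp (-2) * (w t * q t' + w t' * q t) := by
  set Δ := Real.log (w t / q t) - Real.log (w t' / q t') with hΔ
  have hb : 0 < w t / q t := div_pos (hw0 t) (hq0 t)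
  have hb' : 0 < w t' / q t' := div_pos (hw0 t') (hq0 t')
  have he : w t * q t' * Real.exp (-Δ) = w t' * q t := by
    rw [hΔ, neg_sub, Real.exp_sub, Real.exp_log hb', Real.exp_log hb]
    have hq := hq0 t
    have hq' := hq0 t'
    have hw := hw0 t
    field_simp
  have hwq : 0 ≤ w t * q t' := (mul_pos (hw0 t) (hq0 t')).le
  have hcps := accept_mul_sq_le Δ
  rw [imhFlow_eq_mul_accept hw0 hq0 t t', ← hΔ]
  calc w t * q t' * min 1 (Real.exp (-Δ)) * Δ ^ 2
      = w t * q t' * (min 1 (Real.exp (-Δ)) * Δ ^ 2) := by ring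
    _ ≤ w t * q t' * (4 * Real.exp (-2) * (1 + Real.exp (-Δ))) :=
        mul_le_mul_of_nonneg_left hcps hwq
    _ = 4 * Real.exp (-2) * (w t * q t' + w t * q t' * Real.exp (-Δ)) := by ring
    _ = 4 * Real.exp (-2) * (w t * q t' + w t' * q t) := by rw [he]

variable [SFinite μ]

/-- **The mean squared accepted change of any log-weight-Lipschitz observable is at most `8/e²`**
(flow form): for `v` with `|v(t) − v(t')| ≤ |log b(t) − log b(t')|`,
`∫∫ s(t,t') (v(t) − v(t'))² d(μ⊗μ) ≤ 8e^{−2} ∫ w`. -/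
theorem integral_imhFlow_mul_sq_sub_le (hw0 : ∀ t, 0 < w t) (hwi : Integrable w μ)
    (hq0 : ∀ t, 0 < q t) (hqi : Integrable q μ) (hq1 : ∫ z, q z ∂μ = 1) {v : X → ℝ}
    (hvL : ∀ t t', |v t - v t'| ≤ |Real.log (w t / q t) - Real.log (w t' / q t')|) :
    ∫ p, imhFlow w q p.1 p.2 * (v p.1 - v p.2) ^ 2 ∂(μ.prod μ)
      ≤ 8 * Real.exp (-2) * ∫ t, w t ∂μ := by
  have hI1 : Integrable (fun p : X × X => w p.1 * q p.2) (μ.prod μ) := hwi.mul_prod hqi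
  have hI2 : Integrable (fun p : X × X => q p.1 * w p.2) (μ.prod μ) := hqi.mul_prod hwi
  have hR : Integrable (fun p : X × X => 4 * Real.exp (-2) * (w p.1 * q p.2 + q p.1 * w p.2))
      (μ.prod μ) := (hI1.add hI2).const_mul _
  have hmono : ∫ p, imhFlow w q p.1 p.2 * (v p.1 - v p.2) ^ 2 ∂(μ.prod μ)
      ≤ ∫ p, 4 * Real.exp (-2) * (w p.1 * q p.2 + q p.1 * w p.2) ∂(μ.prod μ) := by
    refine integral_mono_of_nonneg (Eventually.of_forall fun p => ?_) hR
      (Eventually.of_forall fun p => ?_)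
    · exact mul_nonneg (imhFlow_nonneg_le hw0 hq0 p.1 p.2).1 (sq_nonneg _)
    · have hs0 := (imhFlow_nonneg_le hw0 hq0 p.1 p.2).1
      have hsq : (v p.1 - v p.2) ^ 2 ≤ (Real.log (w p.1 / q p.1) - Real.log (w p.2 / q p.2)) ^ 2 := by
        rw [← sq_abs, ← sq_abs (Real.log _ - _)]
        exact pow_le_pow_left₀ (abs_nonneg _) (hvL p.1 p.2) 2
      calc imhFlow w q p.1 p.2 * (v p.1 - v p.2) ^ 2
          ≤ imhFlow w q p.1 p.2 * (Real.log (w p.1 / q p.1) - Real.log (w p.2 / q p.2)) ^ 2 :=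
            mul_le_mul_of_nonneg_left hsq hs0
        _ ≤ 4 * Real.exp (-2) * (w p.1 * q p.2 + w p.2 * q p.1) := imhFlow_mul_sq_log_le hw0 hq0 _ _
        _ = 4 * Real.exp (-2) * (w p.1 * q p.2 + q p.1 * w p.2) := by ring
  rw [integral_const_mul, integral_add hI1 hI2, integral_prod_mul (f := w) (g := q),
    integral_prod_mul (f := q) (g := w), hq1] at hmono
  linarith

/-- **THE DIRICHLET FORM OF A LOG-WEIGHT-LIPSCHITZ OBSERVABLE IS AT MOST `4e^{−2} Z`**:
`∫ v² w − ∫ v (Kv) w ≤ 4e^{−2} ∫ w` for `v` bounded measurable moving no more than `log b`. -/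
theorem imh_dirichlet_le_logWeight (hw0 : ∀ t, 0 < w t) (hwm : Measurable w) (hwi : Integrable w μ)
    (hq0 : ∀ t, 0 < q t) (hqm : Measurable q) (hqi : Integrable q μ) (hq1 : ∫ z, q z ∂μ = 1)
    {v : X → ℝ} (hvm : Measurable v) {B : ℝ} (hvb : ∀ t, |v t| ≤ B)
    (hvL : ∀ t t', |v t - v t'| ≤ |Real.log (w t / q t) - Real.log (w t' / q t')|) :
    (∫ t, v t ^ 2 * w t ∂μ) - ∫ t, v t * imhOp μ w q v t * w t ∂μ ≤ 4 * Real.exp (-2) * ∫ t, w t ∂μ := by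
  rw [dirichlet_eq_half_sq hw0 hwm hwi hq0 hqm hqi hq1 hvm hvb]
  have h := integral_imhFlow_mul_sq_sub_le hw0 hwi hq0 hqi hq1 hvL
  linarith

/-- **THE LOG-WEIGHT FLOOR OF THE FLOW SAMPLER (Caracciolo–Pelissetto–Sokal, general measurable
space).**  `w, q > 0` measurable integrable, `∫ q = 1`, `K = imhOp μ w q`; `v` bounded measurable with
`|v(t) − v(t')| ≤ |log b(t) − log b(t')|`, `C(n) = ∫ v (Kⁿ v) w`, `ρ(n) = C(n)/C(0)`.  If the
autocorrelation series is summable and `ρ(1) < 1`, then `τ_int(v) ≥ (e²/4) C(0)/Z − ½`. -/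
theorem imhOp_tauInt_ge_logWeight (hw0 : ∀ t, 0 < w t) (hwm : Measurable w) (hwi : Integrable w μ)
    (hq0 : ∀ t, 0 < q t) (hqm : Measurable q) (hqi : Integrable q μ) (hq1 : ∫ z, q z ∂μ = 1)
    {v : X → ℝ} (hvm : Measurable v) {B : ℝ} (hvb : ∀ t, |v t| ≤ B)
    (hvL : ∀ t t', |v t - v t'| ≤ |Real.log (w t / q t) - Real.log (w t' / q t')|)
    (hs : Summable fun n => (∫ t, v t * ((imhOp μ w q)^[n + 1] v) t * w t ∂μ)
      / ∫ t, v t ^ 2 * w t ∂μ)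
    (hρ : (∫ t, v t * imhOp μ w q v t * w t ∂μ) / (∫ t, v t ^ 2 * w t ∂μ) < 1) :
    Real.exp 2 / 4 * ((∫ t, v t ^ 2 * w t ∂μ) / ∫ t, w t ∂μ) - 1 / 2
      ≤ tauInt (fun n => (∫ t, v t * ((imhOp μ w q)^[n] v) t * w t ∂μ) / ∫ t, v t ^ 2 * w t ∂μ) := by
  have hfloor := imhOp_tauInt_ge hw0 hwm hwi hq0 hqm hqi hq1 hvm hvb hs
  have hdir := imh_dirichlet_le_logWeight hw0 hwm hwi hq0 hqm hqi hq1 hvm hvb hvL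
  set P := ∫ t, v t ^ 2 * w t ∂μ with hP
  set D := 8 * Real.exp (-2) * ∫ t, w t ∂μ with hD
  have hP0 : 0 ≤ P := integral_nonneg fun t => mul_nonneg (sq_nonneg _) (hw0 t).le
  -- `(e²/4) P/Z = 2P/D`
  have hc : (2 : ℝ) / (8 * Real.exp (-2)) = Real.exp 2 / 4 := by
    rw [Real.exp_neg]
    have h0 : Real.exp 2 ≠ 0 := (Real.exp_pos 2).ne'
    field_simp
    norm_num
  have e0 : Real.exp 2 / 4 * (P / ∫ t, w t ∂μ) = 2 * P / D := by
    rw [hD, ← div_mul_div_comm, hc]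
  rw [e0]
  refine le_trans ?_ hfloor
  rcases eq_or_lt_of_le hP0 with hz | hPpos
  · rw [← hz]
    simp only [mul_zero, zero_div, div_zero, sub_zero, add_zero, mul_one, one_div]
    norm_num
  · have h1 : 1 - (∫ t, v t * imhOp μ w q v t * w t ∂μ) / P ≤ D / (2 * P) * (1 - 0) := by
      rw [sub_zero, mul_one]
      have e : 1 - (∫ t, v t * imhOp μ w q v t * w t ∂μ) / P
          = (P - ∫ t, v t * imhOp μ w q v t * w t ∂μ) / P := by
        field_simp
      rw [e, div_le_div_iff₀ hPpos (by positivity)]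
      have hdir' : P - ∫ t, v t * imhOp μ w q v t * w t ∂μ ≤ D / 2 := by
        rw [hD]; linarith [hdir]
      nlinarith [hdir', hPpos]
    have ht := RevOp.floor_transfer hρ h1
    have e2 : 1 / (D / (2 * P) * (1 - (0 : ℝ))) = 2 * P / D := by
      rw [sub_zero, mul_one, one_div_div]
    rw [e2] at ht
    exact ht

end LogWeight

/-! ## Lattice φ⁴: the reweighting energy of a normalizing flow -/

section Lattice

variable {n : ℕ}

/-- The log importance weight of the flow sampler is minus the reweighting energy:
`log(e^{−S(φ)}/q̃(φ)) = −(S(φ) + log q̃(φ))`. -/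
theorem log_gibbsWeight_div (J : Fin (n + 1) → Fin (n + 1) → ℝ) (lam : ℝ)
    {q : (Fin (n + 1) → ℝ) → ℝ} (hq0 : ∀ φ, 0 < q φ) (φ : Fin (n + 1) → ℝ) :
    Real.log (gibbsWeight J lam φ / q φ) = -(latticePhi4Action J lam φ + Real.log (q φ)) := by
  rw [Real.log_div (gibbsWeight_pos J lam φ).ne' (hq0 φ).ne', gibbsWeight, Real.log_exp]
  ring

/-- **THE LOG-WEIGHT FLOOR FOR THE φ⁴ FLOW SAMPLER.**  Every `λ > 0`, every real `J`, every positive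
measurable model density `q̃` with `∫ q̃ = 1` (any normalizing flow); `f` bounded measurable with
`|f ψ − f φ| ≤ |(S ψ + log q̃ ψ) − (S φ + log q̃ φ)|` (any 1-Lipschitz function of the reweighting
energy `S − S_q̃`), `g = f − ⟨f⟩`.  Summable autocorrelation series and `ρ_g(1) < 1` ⇒
`τ_int(f) ≥ (e²/4) ⟨(f − ⟨f⟩)²⟩ − ½`. -/
theorem phi4Flow_tauInt_ge_logWeight {lam : ℝ} (hlam : 0 < lam) (J : Fin (n + 1) → Fin (n + 1) → ℝ)
    {q : (Fin (n + 1) → ℝ) → ℝ} (hq0 : ∀ φ, 0 < q φ) (hqm : Measurable q) (hqi : Integrable q)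
    (hq1 : ∫ φ, q φ = 1) {f : (Fin (n + 1) → ℝ) → ℝ} (hfm : Measurable f) {B : ℝ}
    (hfb : ∀ φ, |f φ| ≤ B)
    (hfL : ∀ ψ φ : Fin (n + 1) → ℝ, |f ψ - f φ|
      ≤ |(latticePhi4Action J lam ψ + Real.log (q ψ)) - (latticePhi4Action J lam φ + Real.log (q φ))|)
    (hs : Summable fun k => (∫ φ, (f φ - gibbsExpect J lam f)
        * ((imhOpPhi4 J lam q)^[k + 1] (fun ψ => f ψ - gibbsExpect J lam f)) φ * gibbsWeight J lam φ)
        / ∫ φ, (f φ - gibbsExpect J lam f) ^ 2 * gibbsWeight J lam φ)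
    (hρ : (∫ φ, (f φ - gibbsExpect J lam f)
        * imhOpPhi4 J lam q (fun ψ => f ψ - gibbsExpect J lam f) φ * gibbsWeight J lam φ)
        / (∫ φ, (f φ - gibbsExpect J lam f) ^ 2 * gibbsWeight J lam φ) < 1) :
    Real.exp 2 / 4 * gibbsExpect J lam (fun φ => (f φ - gibbsExpect J lam f) ^ 2) - 1 / 2
      ≤ tauInt (fun k => (∫ φ, (f φ - gibbsExpect J lam f)
          * ((imhOpPhi4 J lam q)^[k] (fun ψ => f ψ - gibbsExpect J lam f)) φ * gibbsWeight J lam φ)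
          / ∫ φ, (f φ - gibbsExpect J lam f) ^ 2 * gibbsWeight J lam φ) := by
  obtain ⟨hgm, hgb, -⟩ := centred_observable hlam J hfm hfb
  have hgL : ∀ ψ φ : Fin (n + 1) → ℝ,
      |(f ψ - gibbsExpect J lam f) - (f φ - gibbsExpect J lam f)|
        ≤ |Real.log (gibbsWeight J lam ψ / q ψ) - Real.log (gibbsWeight J lam φ / q φ)| := by
    intro ψ φ
    rw [log_gibbsWeight_div J lam hq0, log_gibbsWeight_div J lam hq0,
      show (f ψ - gibbsExpect J lam f) - (f φ - gibbsExpect J lam f) = f ψ - f φ by ring,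
      show -(latticePhi4Action J lam ψ + Real.log (q ψ)) - -(latticePhi4Action J lam φ + Real.log (q φ))
        = -((latticePhi4Action J lam ψ + Real.log (q ψ))
          - (latticePhi4Action J lam φ + Real.log (q φ))) by ring, abs_neg]
    exact hfL ψ φ
  rw [imhOpPhi4_eq_imhOp] at hs hρ ⊢
  have h := imhOp_tauInt_ge_logWeight (μ := volume) (fun φ => gibbsWeight_pos J lam φ)
    (continuous_gibbsWeight J lam).measurable (integrable_gibbsWeight hlam J) hq0 hqm hqi hq1
    hgm hgb hgL hs hρ
  unfold gibbsExpect
  exact h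

/-- The clipped reweighting energy `max(−c, min(c, S + log q̃))` is bounded and measurable. -/
theorem clipReweight_bdd (J : Fin (n + 1) → Fin (n + 1) → ℝ) (lam : ℝ)
    {q : (Fin (n + 1) → ℝ) → ℝ} (hqm : Measurable q) (c : ℝ) :
    Measurable (fun φ : Fin (n + 1) → ℝ => max (-c) (min c (latticePhi4Action J lam φ + Real.log (q φ))))
    ∧ ∀ φ : Fin (n + 1) → ℝ, |max (-c) (min c (latticePhi4Action J lam φ + Real.log (q φ)))| ≤ |c| := by
  refine ⟨measurable_const.max (measurable_const.min
    ((continuous_latticePhi4Action J lam).measurable.add (Real.measurable_log.comp hqm))),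
    fun φ => abs_le.mpr ⟨?_, ?_⟩⟩
  · exact (neg_le_neg (le_abs_self c)).trans (le_max_left _ _)
  · exact max_le (neg_le_abs c) ((min_le_left c _).trans (le_abs_self c))

/-- **THE LOG-WEIGHT FLOOR FOR THE CLIPPED REWEIGHTING ENERGY.**  Every `λ > 0`, real `J`, positive
measurable model density `q̃` with `∫ q̃ = 1`, clip level `c`; `f_c = max(−c, min(c, S + log q̃))`,
`g = f_c − ⟨f_c⟩`: summable autocorrelation series and `ρ_g(1) < 1` ⇒
`τ_int(f_c) ≥ (e²/4) Var_π(f_c) − ½`  (`Var_π(f_c) → σ²_π = Var_π(S + log q̃)` as `c → ∞` whenever the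
log-weight is square-integrable under the target). -/
theorem phi4Flow_tauInt_ge_clipReweight {lam : ℝ} (hlam : 0 < lam)
    (J : Fin (n + 1) → Fin (n + 1) → ℝ) {q : (Fin (n + 1) → ℝ) → ℝ} (hq0 : ∀ φ, 0 < q φ)
    (hqm : Measurable q) (hqi : Integrable q) (hq1 : ∫ φ, q φ = 1) (c : ℝ)
    (hs : Summable fun k =>
      (∫ φ, (max (-c) (min c (latticePhi4Action J lam φ + Real.log (q φ)))
          - gibbsExpect J lam (fun ψ => max (-c) (min c (latticePhi4Action J lam ψ + Real.log (q ψ)))))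
          * ((imhOpPhi4 J lam q)^[k + 1]
            (fun ψ => max (-c) (min c (latticePhi4Action J lam ψ + Real.log (q ψ)))
              - gibbsExpect J lam (fun ψ => max (-c) (min c (latticePhi4Action J lam ψ + Real.log (q ψ)))))) φ
          * gibbsWeight J lam φ)
        / ∫ φ, (max (-c) (min c (latticePhi4Action J lam φ + Real.log (q φ)))
          - gibbsExpect J lam (fun ψ => max (-c) (min c (latticePhi4Action J lam ψ + Real.log (q ψ))))) ^ 2
          * gibbsWeight J lam φ)
    (hρ : (∫ φ, (max (-c) (min c (latticePhi4Action J lam φ + Real.log (q φ)))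
          - gibbsExpect J lam (fun ψ => max (-c) (min c (latticePhi4Action J lam ψ + Real.log (q ψ)))))
          * imhOpPhi4 J lam q
            (fun ψ => max (-c) (min c (latticePhi4Action J lam ψ + Real.log (q ψ)))
              - gibbsExpect J lam (fun ψ => max (-c) (min c (latticePhi4Action J lam ψ + Real.log (q ψ))))) φ
          * gibbsWeight J lam φ)
        / (∫ φ, (max (-c) (min c (latticePhi4Action J lam φ + Real.log (q φ)))
          - gibbsExpect J lam (fun ψ => max (-c) (min c (latticePhi4Action J lam ψ + Real.log (q ψ))))) ^ 2
          * gibbsWeight J lam φ) < 1) :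
    Real.exp 2 / 4 * gibbsExpect J lam (fun φ =>
        (max (-c) (min c (latticePhi4Action J lam φ + Real.log (q φ)))
          - gibbsExpect J lam (fun ψ => max (-c) (min c (latticePhi4Action J lam ψ + Real.log (q ψ))))) ^ 2) - 1 / 2
      ≤ tauInt (fun k =>
        (∫ φ, (max (-c) (min c (latticePhi4Action J lam φ + Real.log (q φ)))
          - gibbsExpect J lam (fun ψ => max (-c) (min c (latticePhi4Action J lam ψ + Real.log (q ψ)))))
          * ((imhOpPhi4 J lam q)^[k]
            (fun ψ => max (-c) (min c (latticePhi4Action J lam ψ + Real.log (q ψ)))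
              - gibbsExpect J lam (fun ψ => max (-c) (min c (latticePhi4Action J lam ψ + Real.log (q ψ)))))) φ
          * gibbsWeight J lam φ)
        / ∫ φ, (max (-c) (min c (latticePhi4Action J lam φ + Real.log (q φ)))
          - gibbsExpect J lam (fun ψ => max (-c) (min c (latticePhi4Action J lam ψ + Real.log (q ψ))))) ^ 2
          * gibbsWeight J lam φ) := by
  obtain ⟨hm, hb⟩ := clipReweight_bdd J lam hqm c
  exact phi4Flow_tauInt_ge_logWeight hlam J hq0 hqm hqi hq1 hm hb
    (fun ψ φ => Literature.Analysis.FunctionSpaces.abs_clamp_sub_clamp_le c _ _) hs hρ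

end Lattice

end Summit.Ventures.LatticeQCDFlow.Exactness
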